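import Summits.ABC.IUTFork.Joshi.BundlingRings
import Summits.ABC.IUTFork.Joshi.ThetaLocusPrototype

/-!
# Joshi's Thm. 7.7.3.1 at one prime with its FIRST input discharged from E-t3's typed local prototype
# ([Joshi 2023b] Thm. 9.2.1, member form) — glue between `Joshi/ThetaLocusPrototype.lean` (E-t3) and `Joshi/BundlingRings.lean` (E-t13)

Block E of the abc-iut cell (rung LADDER-ABC:A2.E; seat abc-iut-E-t13; merge-debt «`locusBE` / `PilotLowerBoundAt` = E-t3's local
locus and prototype bound» of `Joshi/BundlingRings.lean`, p429549). SOURCES: K. Joshi, *Construction of Arithmetic Teichmüller Spaces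
III*, arXiv:2401.13508v4 (`Joshi2024ATS3`), proof of Thm. 7.7.3.1, p. 66 l. 104–120: «By [Joshi, 2023b, Theorem 9.2.1], for each
`𝕍^{odd,ss}_p ≠ ∅`, the set `Θ̃^{B̆}_{Joshi,p}` contains a pure tensor `⊗_{w|p} Z_w` such that `|Z_w|_{B_{E′_w},ρ} ≥ |q_w^{1/2ℓ}|_{ℂ_{p_w}}`
[`^{ℓ⋇}`], with `Z_w` a theta-Pilot object for `X/E′_w` as defined earlier and by [Joshi, 2023b, Theorem 9.2.1] and its proof»; and
K. Joshi, *… II: Proof of a local prototype of Mochizuki's Corollary 3.12*, arXiv:2303.01662v3 (`Joshi2023ATS2Local`) Thm. 9.2.1,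
typed and DERIVED by E-t3 as `Joshi.PrototypeDatum.prototypeBound` over `Joshi.PrototypeDatum` / `CanonicalPoint`. Both UNREFEREED,
disputed; NO SIDE TAKEN on [IUTchIII] Cor. 3.12, on Joshi's claims or on Mochizuki's reports; typed ≠ proved ≠ endorsed.

CONTENT (glue, all PROVED, nothing asserted): (1) `PrototypeDatum.exists_mem_thetaLocus_pow_le` — the MEMBER form of E-t3's
Thm. 9.2.1 (the Θ-pilot tuple of Teichmüller lifts over the canonical ansatz point lies in `Θ̃` and has size `≥ |ξ|_0^{ℓ⋆} =
|q^{1/2ℓ}|^{ℓ⋆}` at every `ρ ∈ (0,1]`; same proof as E-t3's `prototypeBound`, stated before taking the supremum); (2)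
`PrimeBundlingDatum.ofPrototypes` — the §7.5/§7.7 datum whose factor norms `|−|_{B_{E′_w};ρ}`, local loci `Θ̃^{B_{E′_w}}_{Joshi}` and
numbers `|q_w^{1/2ℓ}|` ARE those of a family of E-t3 prototype data `P w` (one per `w | p`, period ring `B_{E′_w}`; this is Joshi's
«[Joshi, 2023b, Theorem 9.2.1] … for `X/E′_w`»), the rest (tensor ring, pure-tensor map, tensor norms, comparison maps) passed
through; (3) `pilotLowerBoundAt_ofPrototypes` — for that datum E-t13's hypothesis `PilotLowerBoundAt ρ` ((7.7.3.3)) is PROVED from the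
canonical points, every `ρ ∈ (0,1]`; (4) `localFundamentalEstimate_ofPrototypes` — hence Thm. 7.7.3.1 at `p` for that datum MODULO
ONLY the cross-norm property (7.7.3.2) (`CrossNormAt ρ`; E-t14's block, see `Joshi/BundlingRingsCrossNorm.lean`). The inputs that
remain are E-t3's SIGNATURE fields (the [FF18] facts inside `PeriodRingDatum`, the canonical point of [FF18 §10]) and (7.7.3.2).

HONEST LIMITS: the family index `lstar` of `BundlingRings` is a parameter while E-t3's `ℓ⋆` is a field, so an equality `hl w :
(P w).lstar = lstar` re-indexes tuples (`Fin.cast`); E-t3's prototype is typed for one `p`-adic base field — instantiating one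
prototype datum per `w` with period ring `B_{E′_w}` is exactly the use Joshi makes of it, not an additional claim; nothing here binds
OUR frozen interface (R14). Standard axioms; sorry-free.
-/

noncomputable section

open Set
open scoped TensorProduct

namespace Summit.ABC.IUTFork.Joshi

/-! ## 1. E-t3's Thm. 9.2.1 in member form -/

namespace PrototypeDatum

variable {F B E0 : Type} [Field F] [CommRing B] [Field E0] {Y : Type} {K : Y → Type} [∀ y, Field (K y)] {G : Type}
  (P : PrototypeDatum F B E0 Y K G)

/-- **[Joshi 2023b] Thm. 9.2.1, MEMBER FORM** (arXiv:2303.01662v3 p. 27 l. 3 – p. 28 l. 50, as DERIVED by E-t3 in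
`prototypeBound`): over the canonical ansatz point the Θ-pilot tuple of Teichmüller lifts `([x_1], …, [x_{ℓ⋆}])` lies in `Θ̃` and
`∏_j |[x_j]|_ρ ≥ |ξ|_0^{ℓ⋆}` for every `ρ ∈ (0,1]` (each coordinate has `|[x_j]|_ρ = |ξ|_0^{j²/ℓ⋆²} ≥ |ξ|_0`, E-t3's
`CanonicalPoint.abs0_xi_le_norm`). This is the form in which J3 Thm. 7.7.3.1's proof consumes Thm. 9.2.1 («contains a pure tensor
`⊗ Z_w` such that `|Z_w| ≥ …`»). PROVED from E-t3's signature. [claim: Joshi2023ATS2Local, status: disputed] -/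
theorem exists_mem_thetaLocus_pow_le (c : P.CanonicalPoint) {ρ : ℝ} (hρ : 0 < ρ) (hρ1 : ρ ≤ 1) :
    ∃ z ∈ P.thetaLocus, P.abs0 P.xi ^ P.lstar ≤ P.tupleSize ρ z := by
  obtain ⟨x, hxT, hx⟩ := P.exists_teich_pilotTuple c.a
  refine ⟨fun i => P.teich (x i), P.pilotGen_subset_thetaLocus ⟨c.a, c.a_mem, hxT⟩, ?_⟩
  unfold PeriodRingDatum.tupleSize
  calc P.abs0 P.xi ^ P.lstar = ∏ _i : Fin P.lstar, P.abs0 P.xi := by simp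
    _ ≤ ∏ i : Fin P.lstar, P.norm ρ (P.teich (x i)) :=
        Finset.prod_le_prod (fun i _ => P.abs0_xi_pos.le) fun i _ => c.abs0_xi_le_norm hρ hρ1 i (hx i)

end PrototypeDatum

/-! ## 2. The §7.5/§7.7 datum built from a family of prototype data, and Thm. 7.7.3.1 modulo (7.7.3.2) -/

namespace ATS3.PrimeBundlingDatum

variable {lstar : ℕ} {Qp Bp : Type} [Field Qp] [CommRing Bp] [Algebra Qp Bp] {I : Type} [Fintype I] [DecidableEq I]
  {E BE : I → Type} [∀ w, Field (E w)] [∀ w, Algebra Qp (E w)] [∀ w, CommRing (BE w)] [∀ w, Algebra Qp (BE w)]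
  [∀ w, Algebra Bp (BE w)] {T : Type} [CommRing T]
  {F E0 : I → Type} [∀ w, Field (F w)] [∀ w, Field (E0 w)] {Y : I → Type} {K : (w : I) → Y w → Type}
  [∀ w y, Field (K w y)] {G : I → Type}
  (P : (w : I) → PrototypeDatum (F w) (BE w) (E0 w) (Y w) (K w) (G w)) (hl : ∀ w, (P w).lstar = lstar)
  (Vp Vss : Finset I) (hV : Vss ⊆ Vp) (toTensE : (w : I) → BE w →ₗ[Qp] Bp ⊗[Qp] E w)
  (tprod : ((w : Vss) → BE w.1) →* T) (normT : ℝ → T → ℝ) (hN : ∀ ρ t, 0 ≤ normT ρ t)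

/-- **The §7.5/§7.7 datum over a family of E-t3 prototype data** `P w` (one for each `w | p`, period ring `B_{E′_w}`, with a
canonical point `c w`): factor norms `|−|_{B_{E′_w};ρ} := (P w).norm ρ`, local loci `Θ̃^{B_{E′_w}}_{Joshi} := (P w).thetaLocus`
(E-t3's Def. 8.3.1 closure, re-indexed along `hl w : (P w).lstar = lstar`), `|q_w^{1/2ℓ}| := |ξ_w|_0 = (P w).abs0 (P w).xi` (E-t3's
`abs0_xi : |ξ|_0 = |q|_0^{1/(2ℓ)}`); tensor ring, pure-tensor map, tensor norms and comparison maps passed through. This is the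
instantiation Joshi makes at p. 66 l. 117–120 («`Z_w` a theta-Pilot object for `X/E′_w` … by [Joshi, 2023b, Theorem 9.2.1]»).
[claim: Joshi2024ATS3, status: disputed] -/
def ofPrototypes : PrimeBundlingDatum lstar Qp Bp I E BE T where
  Vp := Vp
  Vss := Vss
  Vss_subset := hV
  nrm := fun w ρ x => (P w).norm ρ x
  nrm_nonneg := fun w ρ x => (P w).norm_nonneg ρ x
  toTensE := toTensE
  locusBE := fun w => {x | (fun i => x (Fin.cast (hl w) i)) ∈ (P w).thetaLocus}
  tprod := tprod
  normT := normT
  normT_nonneg := hN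
  qRoot := fun w => (P w).abs0 (P w).xi
  qRoot_pos := fun w _ => (P w).abs0_xi_pos

/-- **(7.7.3.3) DISCHARGED for the prototype-built datum**: E-t13's per-`w` pilot lower bound `PilotLowerBoundAt ρ` holds at every
`ρ ∈ (0,1]` — the witness at `w` is the Θ-pilot tuple over the canonical point of `P w` (member form of [Joshi 2023b] Thm. 9.2.1).
PROVED. [folklore] -/
theorem pilotLowerBoundAt_ofPrototypes (c : ∀ w, (P w).CanonicalPoint) {ρ : ℝ} (hρ : 0 < ρ) (hρ1 : ρ ≤ 1) :
    (ofPrototypes P hl Vp Vss hV toTensE tprod normT hN).PilotLowerBoundAt ρ := by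
  intro w _
  obtain ⟨z, hz, hle⟩ := (P w).exists_mem_thetaLocus_pow_le (c w) hρ hρ1
  refine ⟨fun j => z (Fin.cast (hl w).symm j), ?_, ?_⟩
  · show (fun i => z (Fin.cast (hl w).symm (Fin.cast (hl w) i))) ∈ (P w).thetaLocus
    have hzz : (fun i => z (Fin.cast (hl w).symm (Fin.cast (hl w) i))) = z := funext fun i => by simp
    rw [hzz]
    exact hz
  · show (P w).abs0 (P w).xi ^ lstar ≤ ∏ j : Fin lstar, (P w).norm ρ (z (Fin.cast (hl w).symm j))
    have h1 : ∏ j : Fin lstar, (P w).norm ρ (z (Fin.cast (hl w).symm j)) = ∏ i : Fin (P w).lstar, (P w).norm ρ (z i) :=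
      Fintype.prod_equiv (finCongr (hl w).symm) _ _ fun _ => rfl
    have h2 : (P w).abs0 (P w).xi ^ lstar = (P w).abs0 (P w).xi ^ (P w).lstar := by rw [hl w]
    rw [h1, h2]
    simpa [PeriodRingDatum.tupleSize] using hle

/-- **Thm. 7.7.3.1 at `p` MODULO ONLY (7.7.3.2)** for the prototype-built datum: the cross-norm property at some `ρ ∈ (0,1]` gives
`|Θ̃^{B̆⊗}_{Joshi,p}|_{B̆⊗} ≥ ∏_{w ∈ 𝕍^{odd,ss}_p} |q_w^{1/2ℓ}|^{ℓ⋇}`; the first input of Joshi's proof is supplied by E-t3's typed prototype.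
PROVED composition; typed ≠ proved ≠ endorsed. [folklore] -/
theorem localFundamentalEstimate_ofPrototypes (c : ∀ w, (P w).CanonicalPoint) {ρ : ℝ} (hρ : ρ ∈ Set.Ioc (0 : ℝ) 1)
    (hx : (ofPrototypes P hl Vp Vss hV toTensE tprod normT hN).CrossNormAt ρ) :
    (ofPrototypes P hl Vp Vss hV toTensE tprod normT hN).LocalFundamentalEstimate :=
  (ofPrototypes P hl Vp Vss hV toTensE tprod normT hN).localFundamentalEstimate_of_pilot_of_crossNorm hρ
    (pilotLowerBoundAt_ofPrototypes P hl Vp Vss hV toTensE tprod normT hN c hρ.1 hρ.2) hx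

end ATS3.PrimeBundlingDatum

end Summit.ABC.IUTFork.Joshi

end
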